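import Literature.AlgebraicGeometry.Morphisms.FormalFunctions
import HarnessLib

/-!
# Formal functions for `H⁰`: surjectivity from Mittag-Leffler lifting and the kernel bound (Tags 02OB, 02OC)

`Literature/AlgebraicGeometry/Morphisms/FormalFunctions.lean` spells out the surjectivity half of
the theorem on formal functions for `H⁰` (The Stacks Project, Tag 02OC = Cohomology of Schemes,
Theorem 30.20.5, `p = 0`, `𝓕 = 𝒪_X`) as the predicate `HasSurjectiveFormalFunctions I f`: every
family `s_n ∈ Γ(X_n, 𝒪_{X_n})` compatible under the transition maps of the infinitesimal
neighbourhoods `X_n = X ×_A A/I^{n+1}` is `(m_n|_{X_n})_n` for a sequence `m_n ∈ Γ(X, 𝒪_X)` with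
`m_{n+1} - m_n ∈ I^{n+1} Γ(X, 𝒪_X)`.

The printed proof of Tag 02OC derives it from Lemma 30.20.4 (Tag 02OB): "(1) for all `n ≥ c` we
have `Ker(H^p(X, 𝓕) → H^p(X, 𝓕/I^n𝓕)) ⊂ I^{n-c} H^p(X, 𝓕)`. (2) the inverse system
`(H^p(X, 𝓕/I^n𝓕))` satisfies the Mittag-Leffler condition, and (3) we have
`Im(H^p(X, 𝓕/I^k𝓕) → H^p(X, 𝓕/I^n𝓕)) = Im(H^p(X, 𝓕) → H^p(X, 𝓕/I^n𝓕))` for all `k ≥ n + c`"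
— as follows (proof of Theorem 30.20.5): "Set `M = H^p(X, 𝓕)`, `M_n = H^p(X, 𝓕/I^n𝓕)`, and
denote `N_n = Im(M → M_n)`. By Lemma 30.20.4 parts (2) and (3) we see that `(M_n)` is a
Mittag-Leffler system with `N_n ⊂ M_n` equal to the image of `M_k` for all `k ≫ n`. It follows
that `lim M_n = lim N_n` […] `lim N_n` is the completion of `M` with respect to the topology
given by the kernels `K_n = Ker(M → N_n)`. By Lemma 30.20.4 part (1) […]" (the `K_n`-topology is
the `I`-adic one).

This file PROVES exactly that deduction for `p = 0`, `𝓕 = 𝒪_X`, in the tree's spelling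
(`hasSurjectiveFormalFunctions_of_lift_of_ker_le`): `HasSurjectiveFormalFunctions I f` holds as
soon as

* (02OB (3), in the weak form actually used) every member `s_n` of a compatible family lifts to
  `Γ(X, 𝒪_X)` — indeed `s_n` is the image of `s_k`, `k = n + c`, hence lies in
  `Im(Γ(X_k) → Γ(X_n)) = Im(Γ(X) → Γ(X_n))`; and
* (02OB (1)) for some `c`, a global function vanishing on `X_{n+c}` lies in `I^{n+1} Γ(X, 𝒪_X)`,

for ANY ring `A`, ideal `I` and `f : X → Spec A`: choose lifts `m'_n` of the `s_n`; then `m'_k`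
restricts to `s_n` on `X_n` for all `k ≥ n`, so `m_n = m'_{n+c}` restricts to `s_n` and
`m_{n+1} - m_n` vanishes on `X_{n+c}`, i.e. lies in `I^{n+1} Γ(X, 𝒪_X)`. The two hypotheses are
what the coherence theorem supplies for `A` Noetherian and `f` proper (Tag 02OB, from the
finiteness of `⊕_n H⁰(X, I^n𝒪_X)` and `⊕_n H¹(X, I^n𝒪_X)` over the Rees algebra, Lemma 30.20.3,
Tag 02O9); they are not proved here. Consumer: the Noetherian case of the lifting of idempotents
(`Literature/AlgebraicGeometry/Morphisms/IdempotentLiftingFormalFunctions.lean`, Tag 0G7X) in the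
reduction of Zariski's connectedness theorem
(`Literature/AlgebraicGeometry/Morphisms/SteinFactorizationReduction.lean`, Tag 03H2).

## References

* The Stacks Project, Tag 02OC (Cohomology of Schemes, Theorem 30.20.5, proof) and Tag 02OB
  (Lemma 30.20.4 (1), (3)). [StacksProject]
* A. Grothendieck, J. Dieudonné, EGA III₁, 4.1.5–4.1.7. [EGAIII1]
-/

noncomputable section

open CategoryTheory CategoryTheory.Limits AlgebraicGeometry

universe u

namespace Literature.AlgebraicGeometry.Morphisms

open infinitesimalNeighbourhood

set_option backward.isDefEq.respectTransparency false in
/-- **Surjectivity of `Γ(X, 𝒪_X)^∧ → lim_n Γ(X_n, 𝒪_{X_n})` from the Mittag-Leffler lifting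
property and the kernel bound** (the deduction of The Stacks Project, Tag 02OC from Tag 02OB (1),
(3), for `p = 0`, `𝓕 = 𝒪_X`). Let `A` be a ring, `I ⊆ A` an ideal, `f : X → Spec A`. Assume
(a) every member `s_n` of a family `(s_n ∈ Γ(X_n, 𝒪))_n` compatible under the transition maps
is the restriction of a global function on `X` (Tag 02OB (3):
`Im(Γ(X_k) → Γ(X_n)) = Im(Γ(X) → Γ(X_n))` for `k ≥ n + c`), and (b) for some `c`, every global
function vanishing on `X_{n+c}` lies in `I^{n+1} Γ(X, 𝒪_X)` (Tag 02OB (1):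
`Ker(Γ(X) → Γ(X_n)) ⊆ I^{n-c} Γ(X)`). Then `HasSurjectiveFormalFunctions I f`: with lifts `m'_n`
of the `s_n`, `m'_k|_{X_n} = s_n` for all `k ≥ n` (compatibility), so `m_n = m'_{n+c}` restricts
to `s_n`, and `m_{n+1} - m_n` vanishes on `X_{n+c}`, hence lies in `I^{n+1} Γ(X, 𝒪_X)`.
[cite: StacksProject, Tag 02OC (Cohomology of Schemes, Theorem 30.20.5, proof from Lemma 30.20.4 = Tag 02OB (1), (3))] -/
theorem hasSurjectiveFormalFunctions_of_lift_of_ker_le {A : Type u} [CommRing A] (I : Ideal A)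
    {X : Scheme.{u}} (f : X ⟶ Spec (.of A))
    (hlift : ∀ s : (n : ℕ) → Γ(infinitesimalNeighbourhood I f n, ⊤),
      (∀ n, (transition I f n).appTop.hom (s (n + 1)) = s n) →
        ∀ n, s n ∈ Set.range (restrict I f n))
    (c : ℕ) (hker : ∀ (n : ℕ) (m : Γ(X, ⊤)), restrict I f (n + c) m = 0 →
      m ∈ (I ^ (n + 1)).map (algebraMapΓ f)) :
    HasSurjectiveFormalFunctions I f := by
  intro s hs
  choose m' hm' using hlift s hs
  -- `m' k` restricts to `s n` on `X_n` for every `k ≥ n`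
  have hcomp : ∀ j n, restrict I f n (m' (n + j)) = s n := by
    intro j
    induction j with
    | zero => intro n; simpa using hm' n
    | succ j ih =>
      intro n
      rw [← transition_appTop_restrict, show n + (j + 1) = (n + 1) + j by ring, ih (n + 1), hs n]
  refine ⟨fun n ↦ m' (n + c), fun n ↦ ?_, fun n ↦ ?_⟩
  · apply hker
    change restrict I f (n + c) (m' (n + 1 + c) - m' (n + c)) = 0
    have h1 : restrict I f (n + c) (m' (n + 1 + c)) = s (n + c) := by
      rw [show n + 1 + c = (n + c) + 1 by ring]; exact hcomp 1 (n + c)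
    have h0 : restrict I f (n + c) (m' (n + c)) = s (n + c) := by
      simpa using hcomp 0 (n + c)
    rw [map_sub, h1, h0, sub_self]
  · exact hcomp c n

end Literature.AlgebraicGeometry.Morphisms

end
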